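import Summits.FinalStateConjecture.FinalStateConjecture.Theorems.SwallowTheDatumKerrShieldedSettlesStubKerrExteriorFlatDecayAux
import Summits.FinalStateConjecture.FinalStateConjecture.Theorems.KerrShieldedDataExist.Negative.BentSliceConormal
import HarnessLib

/-!
# `KerrShieldedSettles`, line `tapered-temporal-collar` — stub S6b `stub_kerrExteriorFlatDecay`

Support file for crux `stmt-FinalStateConjecture-10054`
(`Summit.FinalStateConjecture.FinalStateConjecture.Theses.SwallowTheDatum.KerrShieldedSettles`):
the `C²` decay, uniform on `{r ≥ ρ₀}`, of the deviation from `η` of the pull-back of the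
Kerr–Schild form `g_{M,a} = η + 2Hℓ ⊗ ℓ` under the bent flat chart `Ψ₀(x) = x + (c₀ + T(r x)) ∂₀`
(`T = bentHeight M a`, `DΨ₀ = id + d(T ∘ r) ⊗ ∂₀`), consumed verbatim by S6a
(`stub_kerrExteriorDecomposition`).

Proof by SCALING (Kerr–Schild 1965, §2; Visser arXiv:0706.0622, (32)–(35)), on top of the Aux
module `…StubKerrExteriorFlatDecayAux` (the family `G = Ĝ`, its reduction `Q` with `Ĝ = μ • Q`,
homogeneity, stationarity, joint smoothness, unit-shell bound; the family is carried by section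
variables `S N D G Q` with defining equations `hS hN hD hG hQ`, instantiated here by `rfl`):
`D^m Ĝ(M, a, ·)(x) = (M/λ) D^m Q(M/λ, a/λ, ·)(x'/λ) ∘ (λ⁻¹ id)^{⊗m}` with `λ = r(x)` and `x'` the
time-translate of `x` to `{x⁰ = 0}` (`norm_iteratedFDeriv_const_smul_comp_smul_le`), whence
`‖D^m Ĝ(M, a, ·)(x)‖ ≤ C_m / r(x)` (`norm_iteratedFDeriv_flatDev_le`); and on the open set `{r > 8M}`
the deviation of the statement IS `Ĝ(M, a, ·)` (`flatDev_eventuallyEq`: stationarity of `g` and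
`T′ = 2Mr/Δ`, `bentSlope_eq_of_ge`), so the iterated derivatives agree there.

References: R. P. Kerr, A. Schild (1965), §2–§3 [KerrSchild1965]; M. Visser, arXiv:0706.0622,
(32)–(35) [arXiv07060622]; M. Dafermos, I. Rodnianski, arXiv:0811.0354, §5.1 [arXiv08110354].
-/

set_option linter.dupNamespace false

noncomputable section

open Set Filter
open scoped Manifold ContDiff Topology
open Literature.Geometry.Lorentzian
open Summit.FinalStateConjecture.FinalStateConjecture.Theorems.KerrShieldedDataExist.Negative
  (bentHeight bentSlope bentSlope_eq_of_ge hasDerivAt_bentHeight mass_pos)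

namespace Summit.FinalStateConjecture.FinalStateConjecture.Theorems.SwallowTheDatum.KerrShieldedSettles

namespace KerrExteriorFlatDecay

section Family

variable {S : ℝ → ℝ → E4 → ℝ}
  (hS : ∀ μ α y, S μ α y =
    2 * Kerr.radius α y / (Kerr.radius α y ^ 2 - 2 * μ * Kerr.radius α y + α ^ 2))
  {N : ℝ → ℝ → E4 → E4 →L[ℝ] E4}
  (hN : ∀ μ α y, N μ α y = (S μ α y • fderiv ℝ (Kerr.radius α) y).smulRight (E4.basisVector 0))
  {D : ℝ → ℝ → E4 → E4 →L[ℝ] E4}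
  (hD : ∀ μ α y, D μ α y = ContinuousLinearMap.id ℝ E4 + μ • N μ α y)
  {G : ℝ → ℝ → E4 → E4 →L[ℝ] E4 →L[ℝ] ℝ}
  (hG : ∀ μ α y, G μ α y = (Kerr.bilin μ α y).bilinearComp (D μ α y) (D μ α y) - Minkowski.bilin)
  {Q : ℝ → ℝ → E4 → E4 →L[ℝ] E4 →L[ℝ] ℝ}
  (hQ : ∀ μ α y, Q μ α y = (Kerr.bilin μ α y).bilinearComp (N μ α y) (D μ α y) +
    (Kerr.bilin μ α y).bilinearComp (ContinuousLinearMap.id ℝ E4) (N μ α y) +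
    (Kerr.bilin 1 α y - Minkowski.bilin))

/-! ### Decay of all derivatives of `Ĝ(M, a, ·)` by scaling -/

include hS hN hD hG hQ in
/-- **Decay of all derivatives of `Ĝ(M, a, ·)`**: for sub-extremal `(M, a)` and every order `m`
there are `C` and `R > 0` with `‖D^m Ĝ(M, a, ·)(x)‖ ≤ C / r(x)` whenever `r(x) ≥ R`. Scaling:
`Ĝ(M, a, ·) = μ • Q(μ, κμ, ·) ∘ (ε ·)` with `ε = 1/r(x)`, `μ = εM`, `κ = a/M`, and the unit-shell
bound at `εx'`, `x'` the time translate of `x` to `{x⁰ = 0}`. [cite: KerrSchild1965, §3] -/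
theorem norm_iteratedFDeriv_flatDev_le {M a : ℝ} (hMa : |a| < M) (m : ℕ) :
    ∃ C R : ℝ, 0 < R ∧ ∀ x : E4, R ≤ Kerr.radius a x →
      ‖iteratedFDeriv ℝ m (G M a) x‖ ≤ C / Kerr.radius a x := by
  have hM : 0 < M := mass_pos hMa
  obtain ⟨κ, hκdef⟩ : ∃ κ : ℝ, κ = a / M := ⟨_, rfl⟩
  have hκ : |κ| ≤ 1 := by
    rw [hκdef, abs_div, abs_of_pos hM, div_le_one hM]
    exact hMa.le
  obtain ⟨B, hB⟩ := exists_bound_iteratedFDeriv_redDev hS hN hD hQ hκ m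
  refine ⟨M * max B 0, max 1 (4 * M), lt_max_of_lt_left one_pos, fun x hx ↦ ?_⟩
  obtain ⟨lam, hlam⟩ : ∃ lam : ℝ, lam = Kerr.radius a x := ⟨_, rfl⟩
  rw [← hlam] at hx ⊢
  have hl1 : 1 ≤ lam := (le_max_left _ _).trans hx
  have hl0 : 0 < lam := one_pos.trans_le hl1
  have hl4 : 4 * M ≤ lam := (le_max_right _ _).trans hx
  obtain ⟨ε, hε⟩ : ∃ ε : ℝ, ε = lam⁻¹ := ⟨_, rfl⟩
  have hε0 : 0 < ε := hε ▸ inv_pos.mpr hl0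
  have hε1 : ε ≤ 1 := hε ▸ inv_le_one_of_one_le₀ hl1
  obtain ⟨μ, hμdef⟩ : ∃ μ : ℝ, μ = ε * M := ⟨_, rfl⟩
  have hμ0 : 0 < μ := hμdef ▸ mul_pos hε0 hM
  have hμ : |μ| ≤ 1 / 4 := by
    rw [abs_of_pos hμ0, hμdef, hε, inv_mul_le_iff₀ hl0]
    linarith
  have hκμ : κ * μ = ε * a := by
    rw [hκdef, hμdef]
    field_simp
  -- zero the time coordinate, then rescale to the unit shell
  obtain ⟨x', hx'⟩ : ∃ x' : E4, x' = x + (-x 0) • E4.basisVector 0 := ⟨_, rfl⟩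
  have hder : iteratedFDeriv ℝ m (G M a) x' = iteratedFDeriv ℝ m (G M a) x :=
    hx' ▸ iteratedFDeriv_flatDev_add_time hS hN hD hG M a m x (-x 0)
  have hrx' : Kerr.radius a x' = lam := by
    rw [hx', hlam]
    exact Kerr.radius_add_time_smul_basisVector a x (-x 0)
  have hy0 : (ε • x') 0 = 0 := by simp [hx']
  have hy1 : Kerr.radius (κ * μ) (ε • x') = 1 := by
    rw [hκμ, Kerr.radius_smul hε0, hrx', hε, inv_mul_cancel₀ hl0.ne']
  -- scaling of the iterated derivative
  have hfun := flatDev_eq_smul_redDev_comp_smul hS hN hD hG hQ hε0 M a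
  rw [← hκμ, ← hμdef] at hfun
  have hcd : ContDiffAt ℝ m (Q μ (κ * μ)) (ε • x') := by
    refine contDiffAt_redDev hS hN hD hQ ?_ (by exact_mod_cast le_top)
    rw [hy1]
    linarith
  have hkey := norm_iteratedFDeriv_const_smul_comp_smul_le (Q μ (κ * μ)) μ hε0.ne' x' hcd
  have hεm : |ε| ^ m ≤ 1 := pow_le_one₀ (abs_nonneg ε) (by rwa [abs_of_pos hε0])
  have hB0 : 0 ≤ max B 0 := le_max_right _ _
  have hBy := hB μ hμ (ε • x') hy0 hy1
  rw [← hder, hfun]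
  refine hkey.trans ?_
  calc |μ| * |ε| ^ m * ‖iteratedFDeriv ℝ m (Q μ (κ * μ)) (ε • x')‖
      ≤ |μ| * 1 * max B 0 :=
        mul_le_mul (mul_le_mul_of_nonneg_left hεm (abs_nonneg μ)) (hBy.trans (le_max_left _ _))
          (norm_nonneg _) (by positivity)
    _ = ε * (M * max B 0) := by
        rw [abs_of_pos hμ0, hμdef]
        ring
    _ = M * max B 0 / lam := by rw [hε, div_eq_inv_mul]

/-! ### The deviation of the statement is `Ĝ(M, a, ·)` on `{r > 8M}` -/

include hS hN hD hG in
/-- On the open set `{r > 8M}` (where `T′ = 2Mr/Δ`, `bentSlope_eq_of_ge`, and `g` is stationary)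
the deviation `Ψ₀^* g_{M,a} − η` of the statement coincides with `Ĝ(M, a, ·)`; in particular they
agree near every point of `{r > 8M}`. [cite: arXiv08110354, §5.1] -/
theorem flatDev_eventuallyEq {M a : ℝ} (hMa : |a| < M) (c₀ : ℝ) {x : E4}
    (hx : 8 * M < Kerr.radius a x) :
    (fun x : E4 ↦
        (Kerr.bilin M a (x + (c₀ + bentHeight M a (Kerr.radius a x)) • E4.basisVector 0)).bilinearComp
            (ContinuousLinearMap.id ℝ E4 +
              (fderiv ℝ (fun y : E4 ↦ bentHeight M a (Kerr.radius a y)) x).smulRight (E4.basisVector 0))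
            (ContinuousLinearMap.id ℝ E4 +
              (fderiv ℝ (fun y : E4 ↦ bentHeight M a (Kerr.radius a y)) x).smulRight (E4.basisVector 0))
          - Minkowski.bilin) =ᶠ[𝓝 x] G M a := by
  have hM : 0 < M := mass_pos hMa
  have hopen : IsOpen {z : E4 | 8 * M < Kerr.radius a z} :=
    isOpen_lt continuous_const (Kerr.continuous_radius a)
  filter_upwards [hopen.mem_nhds hx] with z hz
  have hz' : 8 * M < Kerr.radius a z := hz
  have hz0 : 0 < Kerr.radius a z := by linarith
  have hT : HasDerivAt (bentHeight M a) (bentSlope M a (Kerr.radius a z)) (Kerr.radius a z) :=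
    hasDerivAt_bentHeight hMa _
  have hr : HasFDerivAt (Kerr.radius a) (fderiv ℝ (Kerr.radius a) z) z :=
    ((Kerr.contDiffAt_radius hz0 (n := 1)).differentiableAt one_ne_zero).hasFDerivAt
  have hfd : fderiv ℝ (fun y : E4 ↦ bentHeight M a (Kerr.radius a y)) z =
      (M * S M a z) • fderiv ℝ (Kerr.radius a) z := by
    rw [show (fun y : E4 ↦ bentHeight M a (Kerr.radius a y)) = bentHeight M a ∘ Kerr.radius a from rfl,
      (hT.comp_hasFDerivAt z hr).fderiv, bentSlope_eq_of_ge hM hz'.le, hS]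
    congr 1
    ring
  have hDz : ContinuousLinearMap.id ℝ E4 +
      (fderiv ℝ (fun y : E4 ↦ bentHeight M a (Kerr.radius a y)) z).smulRight (E4.basisVector 0) =
        D M a z := by
    rw [hfd, hD, hN]
    congr 1
    ext v i
    simp only [smul_apply, ContinuousLinearMap.smulRight_apply, smul_eq_mul, smul_smul,
      PiLp.smul_apply, mul_assoc]
  rw [Kerr.bilin_add_smul_basisVector_zero, hDz, hG]

end Family

end KerrExteriorFlatDecay

open KerrExteriorFlatDecay in
/-- **S6b `stub_kerrExteriorFlatDecay` — `C²` decay of the bent-flat-gauge deviation.**  For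
sub-extremal `(M, a)` and any constant `c₀`, the deviation from `η` of the pull-back of the
Kerr–Schild form `g_{M,a} = η + 2Hℓ ⊗ ℓ` under the flat chart `Ψ₀(x) = x + (c₀ + T(r x)) ∂₀`
(`T = bentHeight M a`, `DΨ₀ = id + d(T ∘ r) ⊗ ∂₀`) has all derivatives of order `≤ 2` uniformly small
where the Kerr–Schild radius is large.  Proof: instantiate the Aux module's family by the explicit
lambdas; on `{r > 8M}` the deviation is `Ĝ(M, a, ·)` (`flatDev_eventuallyEq`), and
`‖D^m Ĝ(M, a, ·)(x)‖ ≤ C_m / r(x)` by homogeneity of degree `0` of the Kerr–Schild data under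
`(M, a, x) ↦ (λM, λa, λx)` (`norm_iteratedFDeriv_flatDev_le`). [cite: KerrSchild1965, §2] -/
theorem stub_kerrExteriorFlatDecay : ∀ (M a : ℝ), |a| < M → ∀ (c₀ ε : ℝ), 0 < ε →
    ∃ ρ₀ : ℝ, 0 < ρ₀ ∧ ∀ x : E4, ρ₀ ≤ Kerr.radius a x → ∀ m : ℕ, m ≤ 2 →
      ‖iteratedFDeriv ℝ m (fun x : E4 ↦
          (Kerr.bilin M a (x + (c₀ + bentHeight M a (Kerr.radius a x)) • E4.basisVector 0)).bilinearComp
              (ContinuousLinearMap.id ℝ E4 +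
                (fderiv ℝ (fun y : E4 ↦ bentHeight M a (Kerr.radius a y)) x).smulRight (E4.basisVector 0))
              (ContinuousLinearMap.id ℝ E4 +
                (fderiv ℝ (fun y : E4 ↦ bentHeight M a (Kerr.radius a y)) x).smulRight (E4.basisVector 0))
            - Minkowski.bilin) x‖ ≤ ε := by
  intro M a hMa c₀ ε hε
  have hM : 0 < M := mass_pos hMa
  -- the explicit scaling family of the Aux module (every defining equation holds by `rfl`)
  obtain ⟨S₀, hS⟩ : ∃ S₀ : ℝ → ℝ → E4 → ℝ, ∀ μ α y, S₀ μ α y =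
      2 * Kerr.radius α y / (Kerr.radius α y ^ 2 - 2 * μ * Kerr.radius α y + α ^ 2) :=
    ⟨fun μ α y ↦ _, fun _ _ _ ↦ rfl⟩
  obtain ⟨N₀, hN⟩ : ∃ N₀ : ℝ → ℝ → E4 → E4 →L[ℝ] E4, ∀ μ α y,
      N₀ μ α y = (S₀ μ α y • fderiv ℝ (Kerr.radius α) y).smulRight (E4.basisVector 0) :=
    ⟨fun μ α y ↦ _, fun _ _ _ ↦ rfl⟩
  obtain ⟨D₀, hD⟩ : ∃ D₀ : ℝ → ℝ → E4 → E4 →L[ℝ] E4, ∀ μ α y,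
      D₀ μ α y = ContinuousLinearMap.id ℝ E4 + μ • N₀ μ α y := ⟨fun μ α y ↦ _, fun _ _ _ ↦ rfl⟩
  obtain ⟨G₀, hG⟩ : ∃ G₀ : ℝ → ℝ → E4 → E4 →L[ℝ] E4 →L[ℝ] ℝ, ∀ μ α y,
      G₀ μ α y = (Kerr.bilin μ α y).bilinearComp (D₀ μ α y) (D₀ μ α y) - Minkowski.bilin :=
    ⟨fun μ α y ↦ _, fun _ _ _ ↦ rfl⟩
  obtain ⟨Q₀, hQ⟩ : ∃ Q₀ : ℝ → ℝ → E4 → E4 →L[ℝ] E4 →L[ℝ] ℝ, ∀ μ α y,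
      Q₀ μ α y = (Kerr.bilin μ α y).bilinearComp (N₀ μ α y) (D₀ μ α y) +
        (Kerr.bilin μ α y).bilinearComp (ContinuousLinearMap.id ℝ E4) (N₀ μ α y) +
        (Kerr.bilin 1 α y - Minkowski.bilin) := ⟨fun μ α y ↦ _, fun _ _ _ ↦ rfl⟩
  choose C R hR hCR using fun m : ℕ ↦ norm_iteratedFDeriv_flatDev_le hS hN hD hG hQ hMa m
  obtain ⟨ρ, hρ⟩ : ∃ ρ : ℕ → ℝ, ρ = fun m ↦ max (R m) (max (C m) 0 / ε) := ⟨_, rfl⟩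
  refine ⟨max (8 * M + 1) (max (ρ 0) (max (ρ 1) (ρ 2))), lt_max_of_lt_left (by positivity),
    fun x hx m hm ↦ ?_⟩
  have h8 : 8 * M < Kerr.radius a x := by
    linarith [le_max_left (8 * M + 1) (max (ρ 0) (max (ρ 1) (ρ 2)))]
  have hr0 : 0 < Kerr.radius a x := by linarith
  have hρm : ρ m ≤ Kerr.radius a x := by
    refine le_trans ?_ ((le_max_right _ _).trans hx)
    interval_cases m
    · exact le_max_left _ _
    · exact (le_max_left _ _).trans (le_max_right _ _)
    · exact (le_max_right _ _).trans (le_max_right _ _)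
  rw [hρ] at hρm
  have hRm : R m ≤ Kerr.radius a x := (le_max_left _ _).trans hρm
  have hCm : max (C m) 0 / ε ≤ Kerr.radius a x := (le_max_right _ _).trans hρm
  rw [((flatDev_eventuallyEq hS hN hD hG hMa c₀ h8).iteratedFDeriv ℝ m).eq_of_nhds]
  refine (hCR m x hRm).trans ?_
  calc C m / Kerr.radius a x ≤ max (C m) 0 / Kerr.radius a x := by
        gcongr
        exact le_max_left _ _
    _ ≤ ε := by
        rw [div_le_iff₀ hr0]
        calc max (C m) 0 ≤ Kerr.radius a x * ε := (div_le_iff₀ hε).1 hCm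
          _ = ε * Kerr.radius a x := mul_comm _ _

end Summit.FinalStateConjecture.FinalStateConjecture.Theorems.SwallowTheDatum.KerrShieldedSettles

end
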